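import Mathlib
import HarnessLib
import Summits.HubbardSuperconductivity.HubbardSuperconductivity.Theorems.KLProgrammePerturbedFermiCurveTwoFrame
import Summits.HubbardSuperconductivity.HubbardSuperconductivity.Theorems.KLProgrammeH10TwoPointLimitPerturbedFermiRadiusSmooth
import Summits.HubbardSuperconductivity.HubbardSuperconductivity.Theorems.KLProgrammePolarRayCoareaJacobian

/-!
# Route `KLProgramme` — gen-5 ENGINE child, two-leg slot (E3a-MS): C¹-STABILITY OF THE PERTURBED FERMI RADIUS IN THE PERTURBATION —
# `|u_δ′(θ)' − u_δ(θ)'| ≤ C₀·sup|δ − δ′| + C₁·sup‖Dδ − Dδ′‖` (order 1 of the «C^j-stability» lemma of HOME/prover-p1b/g6/MS-DESIGN.md §2(c))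

Cell `gate-hubbard-kl`, seat p1b (g6).  Order 0 is `abs_perturbedFermiRadius_sub_le` (`…PerturbedFermiCurveTwoFrame`, p479621).  Order 1: with p4's implicit
derivative `u' = −N/D`, `N = ∂_θF + Dδ(u·dir θ)[u·dir(θ+π/2)]`, `D = ∂_tF + Dδ(u·dir θ)[dir θ] ≥ Dt_min − κ₁` (`deriv_of_isRoot`, `Dtmin_sub_le_pertDt`), the
difference of the two quotients is controlled by (i) the `t`-Lipschitz constants of `∂_θF`, `∂_tF` on `[0, 5]` (`|∂_t∂_θF| ≤ 4 + 4t`, `|∂_t∂_tF| ≤ 2` —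
explicit trigonometry), (ii) the Lipschitz constant `κ₂ = sup‖D²δ‖` of `Dδ`, (iii) `sup‖Dδ − Dδ′‖ = η₁`, and (iv) `|u_δ − u_δ′| ≤ η₀/(Dt_min − κ₁)` (order 0).
All radii are `≤ 5` (a point of the closed square on a ray has parameter `≤ π√2`).

* §1 auxiliaries: `radius_le_five_of_isBandFermiRadius`, `abs_rayDispersionDθ_sub_le` (`≤ 24|s − t|` on `[0,5]`; the `∂_tF` twin is k3c2-p2's
  `klrj_rayDispersionDt_lipschitz`),
  `norm_fderiv_sub_fderiv_le_of_norm_fderiv_fderiv_le` (`‖Dδ(p) − Dδ(q)‖ ≤ κ₂‖p − q‖`);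
* §2 **`abs_deriv_perturbedFermiRadius_sub_le`**: the order-1 stability bound with explicit constants.

Everything is PROVED; no definitions; nothing about the model is asserted.  References: BGM 2006 §2.4 Lemma 2.1 (2.40) [cite: BenfattoGiulianiMastropietro2006];
FST IV §1 (inversion: the curve as a Lipschitz function of the dispersion).
-/

noncomputable section

namespace Summit.HubbardSuperconductivity.HubbardSuperconductivity.Theorems.PerturbedFermiCurve

set_option linter.dupNamespace false -- summit = problem name (single-conjunct summit), D-0017

open Real Set
open Literature.MathematicalPhysics.QuantumLattice Literature.MathematicalPhysics.QuantumLattice.BandSectorCounting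

/-! ## §1 Auxiliaries -/

/-- A ray parameter of a point of the closed square is at most `5` (`t ≤ π√2 < 5`). -/
theorem radius_le_five_of_isBandFermiRadius {ν θ t : ℝ} (h : IsBandFermiRadius ν θ t) : t ≤ 5 := by
  have ht0 : 0 ≤ t := h.1.1
  have h0 := abs_apply_le_pi_of_isBandFermiRadius h 0
  have h1 := abs_apply_le_pi_of_isBandFermiRadius h 1
  simp only [Pi.smul_apply, smul_eq_mul, dir, Matrix.cons_val_zero, Matrix.cons_val_one, Matrix.cons_val_fin_one,
    abs_mul, abs_of_nonneg ht0] at h0 h1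
  have hc := Real.cos_sq_add_sin_sq θ
  have hπ := Real.pi_lt_d2
  have hπ0 := Real.pi_pos.le
  have hsq : t ^ 2 ≤ 2 * π ^ 2 := by
    have e0 : (t * |Real.cos θ|) ^ 2 ≤ π ^ 2 := pow_le_pow_left₀ (mul_nonneg ht0 (abs_nonneg _)) h0 2
    have e1 : (t * |Real.sin θ|) ^ 2 ≤ π ^ 2 := pow_le_pow_left₀ (mul_nonneg ht0 (abs_nonneg _)) h1 2
    rw [mul_pow, sq_abs] at e0 e1
    nlinarith
  nlinarith

/-- `∂_t∂_θF`: the `t`-derivative of `rayDispersionDθ θ`. -/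
theorem hasDerivAt_rayDispersionDθ_radius (θ t : ℝ) :
    HasDerivAt (rayDispersionDθ θ)
      (2 * (Real.cos θ * Real.sin (t * Real.sin θ) - Real.sin θ * Real.sin (t * Real.cos θ)) +
        2 * t * (Real.cos θ * (Real.cos (t * Real.sin θ) * Real.sin θ) - Real.sin θ * (Real.cos (t * Real.cos θ) * Real.cos θ))) t := by
  unfold rayDispersionDθ
  have h0 : HasDerivAt (fun s => Real.sin (s * Real.sin θ)) (Real.cos (t * Real.sin θ) * Real.sin θ) t := by
    simpa using ((hasDerivAt_id t).mul_const (Real.sin θ)).sin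
  have h1 : HasDerivAt (fun s => Real.sin (s * Real.cos θ)) (Real.cos (t * Real.cos θ) * Real.cos θ) t := by
    simpa using ((hasDerivAt_id t).mul_const (Real.cos θ)).sin
  have hin := (h0.const_mul (Real.cos θ)).sub (h1.const_mul (Real.sin θ))
  have hlin : HasDerivAt (fun s : ℝ => 2 * s) 2 t := by simpa using (hasDerivAt_id t).const_mul (2 : ℝ)
  have h := hlin.mul hin
  refine h.congr_deriv ?_
  simp only [Pi.sub_apply]

/-- **`∂_θF` is `24`-Lipschitz in `t` on `[0, 5]`** (`|∂_t∂_θF| ≤ 4 + 4t ≤ 24`). -/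
theorem abs_rayDispersionDθ_sub_le (θ : ℝ) {s t : ℝ} (hs : s ∈ Icc (0 : ℝ) 5) (ht : t ∈ Icc (0 : ℝ) 5) :
    |rayDispersionDθ θ s - rayDispersionDθ θ t| ≤ 24 * |s - t| := by
  have hderiv : ∀ x ∈ Icc (0 : ℝ) 5, HasDerivWithinAt (rayDispersionDθ θ)
      (2 * (Real.cos θ * Real.sin (x * Real.sin θ) - Real.sin θ * Real.sin (x * Real.cos θ)) +
        2 * x * (Real.cos θ * (Real.cos (x * Real.sin θ) * Real.sin θ) - Real.sin θ * (Real.cos (x * Real.cos θ) * Real.cos θ)))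
      (Icc (0 : ℝ) 5) x := fun x _ => (hasDerivAt_rayDispersionDθ_radius θ x).hasDerivWithinAt
  have hbound : ∀ x ∈ Icc (0 : ℝ) 5, ‖2 * (Real.cos θ * Real.sin (x * Real.sin θ) - Real.sin θ * Real.sin (x * Real.cos θ)) +
      2 * x * (Real.cos θ * (Real.cos (x * Real.sin θ) * Real.sin θ) - Real.sin θ * (Real.cos (x * Real.cos θ) * Real.cos θ))‖ ≤ 24 := by
    intro x hx
    rw [Real.norm_eq_abs]
    have c1 := Real.abs_cos_le_one θ; have s1 := Real.abs_sin_le_one θ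
    have a1 := Real.abs_sin_le_one (x * Real.sin θ); have a2 := Real.abs_sin_le_one (x * Real.cos θ)
    have b1 := Real.abs_cos_le_one (x * Real.sin θ); have b2 := Real.abs_cos_le_one (x * Real.cos θ)
    have hx0 : 0 ≤ x := hx.1; have hx5 : x ≤ 5 := hx.2
    have t1 : |Real.cos θ * Real.sin (x * Real.sin θ)| ≤ 1 := by
      rw [abs_mul]; nlinarith [abs_nonneg (Real.cos θ), abs_nonneg (Real.sin (x * Real.sin θ))]
    have t2 : |Real.sin θ * Real.sin (x * Real.cos θ)| ≤ 1 := by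
      rw [abs_mul]; nlinarith [abs_nonneg (Real.sin θ), abs_nonneg (Real.sin (x * Real.cos θ))]
    have t3 : |Real.cos θ * (Real.cos (x * Real.sin θ) * Real.sin θ)| ≤ 1 := by
      rw [abs_mul, abs_mul]
      nlinarith [abs_nonneg (Real.cos θ), abs_nonneg (Real.sin θ), abs_nonneg (Real.cos (x * Real.sin θ)),
        mul_nonneg (abs_nonneg (Real.cos (x * Real.sin θ))) (abs_nonneg (Real.sin θ))]
    have t4 : |Real.sin θ * (Real.cos (x * Real.cos θ) * Real.cos θ)| ≤ 1 := by
      rw [abs_mul, abs_mul]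
      nlinarith [abs_nonneg (Real.sin θ), abs_nonneg (Real.cos θ), abs_nonneg (Real.cos (x * Real.cos θ)),
        mul_nonneg (abs_nonneg (Real.cos (x * Real.cos θ))) (abs_nonneg (Real.cos θ))]
    have d1 := abs_sub (Real.cos θ * Real.sin (x * Real.sin θ)) (Real.sin θ * Real.sin (x * Real.cos θ))
    have d2 := abs_sub (Real.cos θ * (Real.cos (x * Real.sin θ) * Real.sin θ)) (Real.sin θ * (Real.cos (x * Real.cos θ) * Real.cos θ))
    have hA : |2 * (Real.cos θ * Real.sin (x * Real.sin θ) - Real.sin θ * Real.sin (x * Real.cos θ))| ≤ 4 := by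
      rw [abs_mul, abs_two]; linarith
    have hB : |2 * x * (Real.cos θ * (Real.cos (x * Real.sin θ) * Real.sin θ) - Real.sin θ * (Real.cos (x * Real.cos θ) * Real.cos θ))| ≤ 20 := by
      rw [abs_mul, abs_mul, abs_two, abs_of_nonneg hx0]
      nlinarith [abs_nonneg (Real.cos θ * (Real.cos (x * Real.sin θ) * Real.sin θ) - Real.sin θ * (Real.cos (x * Real.cos θ) * Real.cos θ))]
    have := abs_add_le (2 * (Real.cos θ * Real.sin (x * Real.sin θ) - Real.sin θ * Real.sin (x * Real.cos θ)))
      (2 * x * (Real.cos θ * (Real.cos (x * Real.sin θ) * Real.sin θ) - Real.sin θ * (Real.cos (x * Real.cos θ) * Real.cos θ)))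
    linarith
  have h := (convex_Icc (0 : ℝ) 5).norm_image_sub_le_of_norm_hasDerivWithin_le hderiv hbound ht hs
  simpa only [Real.norm_eq_abs] using h

/-- **`Dδ` is `κ₂`-Lipschitz** when `δ ∈ C²` with `‖D²δ‖ ≤ κ₂` everywhere. -/
theorem norm_fderiv_sub_fderiv_le_of_norm_fderiv_fderiv_le {δ : (Fin 2 → ℝ) → ℝ} (hδ : ContDiff ℝ 2 δ) {κ₂ : ℝ}
    (hκ₂ : ∀ k : Fin 2 → ℝ, ‖fderiv ℝ (fderiv ℝ δ) k‖ ≤ κ₂) (p q : Fin 2 → ℝ) :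
    ‖fderiv ℝ δ p - fderiv ℝ δ q‖ ≤ κ₂ * ‖p - q‖ := by
  have hd : Differentiable ℝ (fderiv ℝ δ) := by
    have h1 : ContDiff ℝ 1 (fderiv ℝ δ) := hδ.fderiv_right (by norm_num)
    exact h1.differentiable one_ne_zero
  exact (convex_univ).norm_image_sub_le_of_norm_fderiv_le (fun x _ => hd x) (fun x _ => hκ₂ x) (Set.mem_univ q) (Set.mem_univ p)


/-! ## §2 Order-1 stability of the perturbed Fermi radius in the perturbation -/

section TwoPerturbationsDeriv

variable {a b : ℝ} (B : BandBounds a b) {δ δ' : (Fin 2 → ℝ) → ℝ} (hδc : ContDiff ℝ 2 δ) (hδc' : ContDiff ℝ 2 δ')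
  {κ₀ κ₁ κ₂ μ : ℝ} (hδ : ∀ k : Fin 2 → ℝ, (∀ i, |k i| ≤ π) → |δ k| ≤ κ₀)
  (hδ' : ∀ k : Fin 2 → ℝ, (∀ i, |k i| ≤ π) → |δ' k| ≤ κ₀) (hlo : a ≤ μ - κ₀) (hhi : μ + κ₀ ≤ b)
  (hκ : ∀ k : Fin 2 → ℝ, ‖fderiv ℝ δ k‖ ≤ κ₁) (hκ' : ∀ k : Fin 2 → ℝ, ‖fderiv ℝ δ' k‖ ≤ κ₁) (hκ₁ : κ₁ < B.Dtmin)
  (hκ₂ : ∀ k : Fin 2 → ℝ, ‖fderiv ℝ (fderiv ℝ δ) k‖ ≤ κ₂)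
  {η₀ η₁ : ℝ} (hη₀ : ∀ k : Fin 2 → ℝ, (∀ i, |k i| ≤ π) → |δ k - δ' k| ≤ η₀)
  (hη₁ : ∀ k : Fin 2 → ℝ, ‖fderiv ℝ δ k - fderiv ℝ δ' k‖ ≤ η₁)
include B hδc hδc' hδ hδ' hlo hhi hκ hκ' hκ₁ hκ₂ hη₀ hη₁

/-- **C¹-STABILITY OF THE PERTURBED FERMI RADIUS IN THE PERTURBATION** (order 1 of MS-DESIGN §2(c)).  For `δ, δ′ ∈ C²` with `|δ|, |δ′| ≤ κ₀` on
the closed square, `[μ − κ₀, μ + κ₀] ⊂ [a, b]`, `‖Dδ‖, ‖Dδ′‖ ≤ κ₁ < Dt_min`, `‖D²δ‖ ≤ κ₂`, `|δ − δ′| ≤ η₀` on the closed square and `‖Dδ − Dδ′‖ ≤ η₁`: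
with `d = Dt_min − κ₁`,
`|u_δ'(θ) − u_δ′'(θ)| ≤ ((24 + 5κ₂ + κ₁)·(η₀/d) + 5η₁)/d + 5(4 + κ₁)·((2 + κ₂)·(η₀/d) + η₁)/d²` — LINEAR in `(η₀, η₁)`, the sizes of `δ − δ′`.
[cite: BenfattoGiulianiMastropietro2006, §2.4 Lemma 2.1 (2.40)] -/
theorem abs_deriv_perturbedFermiRadius_sub_le (θ : ℝ) :
    |deriv (perturbedFermiRadius δ μ) θ - deriv (perturbedFermiRadius δ' μ) θ| ≤
      ((24 + 5 * κ₂ + κ₁) * (η₀ / (B.Dtmin - κ₁)) + 5 * η₁) / (B.Dtmin - κ₁) +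
        5 * (4 + κ₁) * ((2 + κ₂) * (η₀ / (B.Dtmin - κ₁)) + η₁) / (B.Dtmin - κ₁) ^ 2 := by
  set u := perturbedFermiRadius δ μ with hudef
  set v := perturbedFermiRadius δ' μ with hvdef
  set d := B.Dtmin - κ₁ with hddef
  have hd : 0 < d := sub_pos.2 hκ₁
  -- root selections and the implicit derivatives
  have hu : ∀ ϑ, IsBandFermiRadius (μ - δ (u ϑ • dir ϑ)) ϑ (u ϑ) := isBandFermiRadius_perturbedFermiRadius B hδc.continuous hδ hlo hhi
  have hv : ∀ ϑ, IsBandFermiRadius (μ - δ' (v ϑ • dir ϑ)) ϑ (v ϑ) := isBandFermiRadius_perturbedFermiRadius B hδc'.continuous hδ' hlo hhi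
  have h2 : (2 : WithTop ℕ∞) ≠ 0 := by norm_num
  have hdu := deriv_of_isRoot B hδc h2 hδ hlo hhi (fun k _ => hκ k) hκ₁ hu θ
  have hdv := deriv_of_isRoot B hδc' h2 hδ' hlo hhi (fun k _ => hκ' k) hκ₁ hv θ
  set Nu := rayDispersionDθ θ (u θ) + fderiv ℝ δ (u θ • dir θ) (u θ • dir (θ + π / 2)) with hNu
  set Du := rayDispersionDt θ (u θ) + fderiv ℝ δ (u θ • dir θ) (dir θ) with hDu
  set Nv := rayDispersionDθ θ (v θ) + fderiv ℝ δ' (v θ • dir θ) (v θ • dir (θ + π / 2)) with hNv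
  set Dv := rayDispersionDt θ (v θ) + fderiv ℝ δ' (v θ • dir θ) (dir θ) with hDv
  have hDu_ge : d ≤ Du := Dtmin_sub_le_pertDt B hδ hlo hhi (fun k _ => hκ k) hu θ
  have hDv_ge : d ≤ Dv := Dtmin_sub_le_pertDt B hδ' hlo hhi (fun k _ => hκ' k) hv θ
  have hDu0 : 0 < Du := hd.trans_le hDu_ge
  have hDv0 : 0 < Dv := hd.trans_le hDv_ge
  -- sizes of the radii
  have hu0 : 0 < u θ := (mem_Ioo_of_shifted B hδ hlo hhi (hu θ)).1
  have hv0 : 0 < v θ := (mem_Ioo_of_shifted B hδ' hlo hhi (hv θ)).1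
  have hu5 : u θ ≤ 5 := radius_le_five_of_isBandFermiRadius (hu θ)
  have hv5 : v θ ≤ 5 := radius_le_five_of_isBandFermiRadius (hv θ)
  have huI : u θ ∈ Icc (0 : ℝ) 5 := ⟨hu0.le, hu5⟩
  have hvI : v θ ∈ Icc (0 : ℝ) 5 := ⟨hv0.le, hv5⟩
  -- order 0: `|u − v| ≤ η₀/d`
  have hL := radialLipschitz_of_fderiv_le (fun k _ => (hδc.differentiable h2) k) (fun k _ => hκ k) θ
  have hρ : |u θ - v θ| ≤ η₀ / d := abs_perturbedFermiRadius_sub_le B hδc.continuous hδc'.continuous hδ hδ' hlo hhi hL hκ₁ hη₀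
  have hρ0 : 0 ≤ η₀ / d := (abs_nonneg _).trans hρ
  have hκ₁0 : 0 ≤ κ₁ := (norm_nonneg _).trans (hκ 0)
  have hκ₂0 : 0 ≤ κ₂ := le_trans (norm_nonneg (fderiv ℝ (fderiv ℝ δ) 0)) (hκ₂ 0)
  have hη₁0 : 0 ≤ η₁ := (norm_nonneg _).trans (hη₁ 0)
  -- norms of ray points
  have hnorm : ∀ (t ϑ : ℝ), ‖t • dir ϑ‖ ≤ |t| := fun t ϑ => by
    rw [norm_smul, Real.norm_eq_abs]; exact mul_le_of_le_one_right (abs_nonneg _) (norm_dir_le_one ϑ)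
  have hLipD : ‖fderiv ℝ δ (u θ • dir θ) - fderiv ℝ δ (v θ • dir θ)‖ ≤ κ₂ * |u θ - v θ| := by
    refine (norm_fderiv_sub_fderiv_le_of_norm_fderiv_fderiv_le hδc hκ₂ _ _).trans ?_
    rw [← sub_smul]
    exact mul_le_mul_of_nonneg_left (hnorm _ _) hκ₂0
  -- `|Nu| ≤ (4 + κ₁)·5`
  have hNu_le : |Nu| ≤ 5 * (4 + κ₁) := by
    have h1 := abs_rayDispersionDθ_le θ (u θ)
    have h2' := abs_fderiv_smul_dir_le (hκ (u θ • dir θ)) (u θ) (θ + π / 2)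
    rw [abs_of_pos hu0] at h1 h2'
    have := abs_add_le (rayDispersionDθ θ (u θ)) (fderiv ℝ δ (u θ • dir θ) (u θ • dir (θ + π / 2)))
    nlinarith
  -- `|Nu − Nv| ≤ (24 + 5κ₂ + κ₁)|u − v| + 5η₁`
  have hN : |Nu - Nv| ≤ (24 + 5 * κ₂ + κ₁) * |u θ - v θ| + 5 * η₁ := by
    have e1 := abs_rayDispersionDθ_sub_le θ huI hvI
    have a1 : |fderiv ℝ δ (u θ • dir θ) (u θ • dir (θ + π / 2)) - fderiv ℝ δ (v θ • dir θ) (u θ • dir (θ + π / 2))| ≤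
        5 * κ₂ * |u θ - v θ| := by
      rw [← sub_apply, ← Real.norm_eq_abs]
      refine (ContinuousLinearMap.le_opNorm _ _).trans ?_
      have hn := (hnorm (u θ) (θ + π / 2)).trans_eq (abs_of_pos hu0)
      calc ‖fderiv ℝ δ (u θ • dir θ) - fderiv ℝ δ (v θ • dir θ)‖ * ‖u θ • dir (θ + π / 2)‖
          ≤ κ₂ * |u θ - v θ| * 5 := mul_le_mul hLipD (hn.trans hu5) (norm_nonneg _) (by positivity)
        _ = 5 * κ₂ * |u θ - v θ| := by ring
    have a2 : |fderiv ℝ δ (v θ • dir θ) (u θ • dir (θ + π / 2)) - fderiv ℝ δ (v θ • dir θ) (v θ • dir (θ + π / 2))| ≤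
        κ₁ * |u θ - v θ| := by
      rw [← map_sub, ← sub_smul]
      exact abs_fderiv_smul_dir_le (hκ _) _ _
    have a3 : |fderiv ℝ δ (v θ • dir θ) (v θ • dir (θ + π / 2)) - fderiv ℝ δ' (v θ • dir θ) (v θ • dir (θ + π / 2))| ≤ 5 * η₁ := by
      rw [← sub_apply, ← Real.norm_eq_abs]
      refine (ContinuousLinearMap.le_opNorm _ _).trans ?_
      have hn := (hnorm (v θ) (θ + π / 2)).trans_eq (abs_of_pos hv0)
      calc ‖fderiv ℝ δ (v θ • dir θ) - fderiv ℝ δ' (v θ • dir θ)‖ * ‖v θ • dir (θ + π / 2)‖ ≤ η₁ * 5 :=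
            mul_le_mul (hη₁ _) (hn.trans hv5) (norm_nonneg _) hη₁0
        _ = 5 * η₁ := by ring
    have hsplit : Nu - Nv = (rayDispersionDθ θ (u θ) - rayDispersionDθ θ (v θ)) +
        ((fderiv ℝ δ (u θ • dir θ) (u θ • dir (θ + π / 2)) - fderiv ℝ δ (v θ • dir θ) (u θ • dir (θ + π / 2))) +
         (fderiv ℝ δ (v θ • dir θ) (u θ • dir (θ + π / 2)) - fderiv ℝ δ (v θ • dir θ) (v θ • dir (θ + π / 2))) +
         (fderiv ℝ δ (v θ • dir θ) (v θ • dir (θ + π / 2)) - fderiv ℝ δ' (v θ • dir θ) (v θ • dir (θ + π / 2)))) := by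
      simp only [hNu, hNv]; ring
    rw [hsplit]
    refine (abs_add_le _ _).trans ?_
    have := (abs_add_le _ _).trans (add_le_add ((abs_add_le _ _).trans (add_le_add a1 a2)) a3)
    nlinarith [abs_nonneg (u θ - v θ)]
  -- `|Du − Dv| ≤ (2 + κ₂)|u − v| + η₁`
  have hD : |Du - Dv| ≤ (2 + κ₂) * |u θ - v θ| + η₁ := by
    have e1 := KLRegimeSplit.klrj_rayDispersionDt_lipschitz θ (u θ) (v θ)
    have b1 : |fderiv ℝ δ (u θ • dir θ) (dir θ) - fderiv ℝ δ (v θ • dir θ) (dir θ)| ≤ κ₂ * |u θ - v θ| := by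
      rw [← sub_apply, ← Real.norm_eq_abs]
      refine (ContinuousLinearMap.le_opNorm _ _).trans ?_
      calc ‖fderiv ℝ δ (u θ • dir θ) - fderiv ℝ δ (v θ • dir θ)‖ * ‖dir θ‖ ≤ κ₂ * |u θ - v θ| * 1 :=
            mul_le_mul hLipD (norm_dir_le_one θ) (norm_nonneg _) (by positivity)
        _ = κ₂ * |u θ - v θ| := by ring
    have b3 : |fderiv ℝ δ (v θ • dir θ) (dir θ) - fderiv ℝ δ' (v θ • dir θ) (dir θ)| ≤ η₁ := by
      rw [← sub_apply, ← Real.norm_eq_abs]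
      refine (ContinuousLinearMap.le_opNorm _ _).trans ?_
      calc ‖fderiv ℝ δ (v θ • dir θ) - fderiv ℝ δ' (v θ • dir θ)‖ * ‖dir θ‖ ≤ η₁ * 1 :=
            mul_le_mul (hη₁ _) (norm_dir_le_one θ) (norm_nonneg _) hη₁0
        _ = η₁ := by ring
    have hsplit : Du - Dv = (rayDispersionDt θ (u θ) - rayDispersionDt θ (v θ)) +
        ((fderiv ℝ δ (u θ • dir θ) (dir θ) - fderiv ℝ δ (v θ • dir θ) (dir θ)) +
         (fderiv ℝ δ (v θ • dir θ) (dir θ) - fderiv ℝ δ' (v θ • dir θ) (dir θ))) := by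
      simp only [hDu, hDv]; ring
    rw [hsplit]
    refine (abs_add_le _ _).trans ?_
    have := (abs_add_le _ _).trans (add_le_add b1 b3)
    nlinarith [abs_nonneg (u θ - v θ)]
  -- the quotient split
  have hq : deriv u θ - deriv v θ = ((Nv - Nu) * Du + Nu * (Du - Dv)) / (Du * Dv) := by
    rw [hdu, hdv]
    field_simp
    ring
  have hnum : |(Nv - Nu) * Du + Nu * (Du - Dv)| ≤ |Nu - Nv| * Du + |Nu| * |Du - Dv| := by
    refine (abs_add_le _ _).trans ?_
    rw [abs_mul, abs_mul, abs_sub_comm Nv Nu, abs_of_pos hDu0]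
  have hquot : |deriv u θ - deriv v θ| ≤ |Nu - Nv| / d + |Nu| * |Du - Dv| / d ^ 2 := by
    rw [hq, abs_div, abs_of_pos (mul_pos hDu0 hDv0)]
    have h1 : (|Nu - Nv| * Du + |Nu| * |Du - Dv|) / (Du * Dv) = |Nu - Nv| / Dv + |Nu| * |Du - Dv| / (Du * Dv) := by
      field_simp
    refine (div_le_div_of_nonneg_right hnum (mul_pos hDu0 hDv0).le).trans ?_
    rw [h1]
    refine add_le_add (div_le_div_of_nonneg_left (abs_nonneg _) hd hDv_ge) ?_
    refine div_le_div_of_nonneg_left (by positivity) (by positivity) ?_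
    rw [sq]; exact mul_le_mul hDu_ge hDv_ge hd.le hDu0.le
  -- assemble
  have hN' : |Nu - Nv| ≤ (24 + 5 * κ₂ + κ₁) * (η₀ / d) + 5 * η₁ := by
    have : (24 + 5 * κ₂ + κ₁) * |u θ - v θ| ≤ (24 + 5 * κ₂ + κ₁) * (η₀ / d) := mul_le_mul_of_nonneg_left hρ (by positivity)
    linarith
  have hD' : |Du - Dv| ≤ (2 + κ₂) * (η₀ / d) + η₁ := by
    have : (2 + κ₂) * |u θ - v θ| ≤ (2 + κ₂) * (η₀ / d) := mul_le_mul_of_nonneg_left hρ (by positivity)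
    linarith
  have hprod : |Nu| * |Du - Dv| ≤ 5 * (4 + κ₁) * ((2 + κ₂) * (η₀ / d) + η₁) :=
    mul_le_mul hNu_le hD' (abs_nonneg _) (by positivity)
  calc |deriv u θ - deriv v θ| ≤ |Nu - Nv| / d + |Nu| * |Du - Dv| / d ^ 2 := hquot
    _ ≤ ((24 + 5 * κ₂ + κ₁) * (η₀ / d) + 5 * η₁) / d + 5 * (4 + κ₁) * ((2 + κ₂) * (η₀ / d) + η₁) / d ^ 2 := by
      gcongr

end TwoPerturbationsDeriv

end Summit.HubbardSuperconductivity.HubbardSuperconductivity.Theorems.PerturbedFermiCurve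

end
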